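import Summits.BirchSwinnertonDyer.BirchSwinnertonDyer.Theorems.KatoDescentPotSupersingularWildUpperMuRoadThreeFukudaRecords29
import Literature.NumberTheory.EllipticCurves.FineSelmerLimThm35Proofs
import Literature.NumberTheory.EllipticCurves.FineSelmerClassGroupCriterionThm34Proofs
import Literature.NumberTheory.IwasawaTheory.Fukuda1994Thm1Proofs
import Literature.NumberTheory.IwasawaTheory.Fukuda1994Thm1RankProofs
import HarnessLib

/-!
# NoF RE-ISSUE (seat `bsd-potss-k9-c4` g25, 2026-08-29; `--supports stmt-BirchSwinnertonDyer-19197 --as helper`) of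
# `KatoDescentPotSupersingularWildUpperMuRoadThreeFukudaRecords29.lean`:
# the SAME per-row theorems with the μ-road named facts that are now TREE THEOREMS no longer displayed as hypotheses —
# `hLim` (Lim 2017 Thm. 3.5) := `Lim2017.thm35_fineSelmerDual_moduleFinite_of_classicalMuVanishes_of_le_divisionField_holds` (rkm g34, p695193),
# `hF1` (Fukuda 1994 Thm. 1 (1)) := `IwasawaTheory.fukuda1994_thm1_classNumberPExp_const_of_succ_eq_holds` (k8t-c4 g20),
# `hF2` (Fukuda 1994 Thm. 1 (2)) := `IwasawaTheory.fukuda1994_thm1_classGroupPRank_const_of_succ_eq_holds` (k8t-c4 g20, p681350),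
# `hCS` (Coates–Sujatha 2005 Thm. 3.4) := `CoatesSujatha2005.thm34_fineSelmerDual_moduleFinite_of_classicalMuVanishes_divisionField_holds` (k8t-c4 g22, p694085).

HONEST FRAMING. THEOREMS ONLY; PER ROW; nothing booked; items 19189 / 19197 / 19942 stay OPEN at class level (open input of record: the zeta crux 24327);
(A) / Conjecture A / BSD proved for NO class of curves.  Every theorem below is the original record (same name + suffix `NoF`, same displayed NUMERIC
hypotheses, same kernel certificates, same proof term) with the discharged fact binders deleted and the `_holds` theorems substituted in the proof; the
remaining displayed named facts are exactly those the original displays minus {hLim, hF1, hF2, hCS} (for the `GL₂(𝔽₃)` `L_P`-road records: NONE beyond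
`hKatoA hGZK hmod` on the U₀ twin — statement (A) at `(E,3)` becomes a kernel theorem modulo the displayed numerics of `L_P` alone; for the Cartan
unit-index / Fukuda records: Ferrero–Washington `hFW` only).  Row section headers, numerics, evidence pointers and citations are those of the original
file VERBATIM (its module docstring is reproduced below under «ORIGINAL HEADER»); the per-theorem docstrings are the originals prefixed with the NoF marker.

ORIGINAL HEADER of `KatoDescentPotSupersingularWildUpperMuRoadThreeFukudaRecords29`:

> # Route `KatoDescentPotSupersingular` (rung K9, sub-rung B5 = O6 wild `p = 3`, cell `bsd-potss`): per-row U₀ RECORDS BY FUKUDA'S `3`-RANK CRITERION (Thm. 1 (2)) ON THE MAXIMAL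
> # REAL SUBFIELD `K⁺ = ℚ(E[3])^c` (degree 4, `3Ns` rows) AT LAYERS `(1,2)` — quartic K6 = `x⁴ + 26x² − 156` (rows 292032ej1, 292032en1), where door UG's unit-index condition
> # FAILS at layer 1 (symbol rank 1 < s − 1 = 2), so by Chevalley's ambiguous class number formula the ORDER form is provably dead at `(1,2)` and only the RANK form can apply —
> # decided by the direct degree-36 layer (this seat's kit j316854, GRH), `K⁺` part 29
> # (seat `bsd-potss-k9-c4` g23; door `CartanMuRoadFukudaDoorsWild.missingUpperBoundAt_three_of_hasSplitCartanNormalizerModPImage_of_realRankSuccEqAt` (k8t-c4 g19); record shape =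
> # k9-c4 g22's `…FukudaRecords23` (`_fkK12r`, 417501i1) verbatim; `--supports stmt-BirchSwinnertonDyer-19197 --as helper`)
> 
> HONEST FRAMING. THEOREMS ONLY (no definition, no named fact, no `sorry`); PER ROW — NOT a class theorem; nothing is booked; items 19189 / 19197 (and, for the
> residue rows, 19942) stay OPEN at class level (class-wide open input: the zeta crux 24327); (A), Conjecture A and BSD are proved for NO curve here.  On these rows the
> classical `μ`-roads at layers `(0,1)` are ALL silent: on `L = ℚ(E[3])` (`e₀(L) < e₁(L)`, conjA-anchor g8) and on the real quartic `K⁺ = L^c` (`e₀(K⁺) = 0 < e₁(K⁺)`,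
> k9-c4 g22 kit j314795, both layers certified).  `μ(L_cyc) = 0` follows from `μ(K⁺_cyc) = 0` (k9-c4 g18's `CartanMuRoadRealDoors`: complex conjugation discharges the
> involution binders of conjA-anchor g11's Cartan road; Ferrero–Washington `hFW` for the passage), and `μ(K⁺_cyc) = 0` from FUKUDA 1994 Thm. 1 at layers `(1, 2)` on `K⁺`
> (named fact `hF1` = (1) orders / `hF2` = (2) `3`-ranks), Fukuda's index hypothesis being DISCHARGED by Serre's Prop. 15 inside the door.
> ROAD = `MissingUpperBoundAt E 3 ⟸` NAMED FACTS `hKatoA hGZK hmod hCS hFW hF1` (resp. `hF2`) `+` Cremona's `r_an = 0` (`hr`) `+` KERNEL (imported: `Δ ≠ 0`, minimality,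
> `irr_g…_3`, `classO6_g…_3`; proved here or imported: `Ψ₃ = (X² + bX + c)·q` over `ℚ` with `b² − 4c ≠ 0` ⟹ image in the normaliser of a split Cartan,
> `ModThreeSplitCartanCertificate.hasSplitCartanNormalizerModPImage_three_of_Ψ₃_eq_mul`, k9-c4 g18) `+` a complex conjugation `c` (hypothesis `hc`, exists) `+` ONE
> NUMERIC hypothesis `hord : e₂(K⁺) = e₁(K⁺)` (resp. `hrk : r₂(K⁺) = r₁(K⁺)`) for every cyclotomic `ℤ₃`-extension of `K⁺ := Fix(c|_L)`.
> NUMERICS (quoted per row, not kernel-checked): layers 0/1 are k9-c4 g22's kit j314795 (`k9cert3.gp`: `ψ₃` factorisation, `K⁺ ≅ ℚ(P)` for a REAL `3`-torsion point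
> `P`, `h(K⁺) = 2` CERT, `h(K⁺₁) = 6` with `K⁺₁ = K⁺·ℚ(ζ₉)⁺` of degree 12 — GRH (`bnfcertify` > 600 s in j315805, > 3000 s attempted in j316906)); THIS SEAT's kit j315805 (door UG
> at `(1,2)` on `F = K⁺₁`): `s = 3` primes above `3`, unit norm symbols of rank `1 < s − 1 = 2`, prime classes do NOT generate `A(F)`, so Chevalley's formula gives
> `#A(K⁺₂)^G = #A(K⁺₁)·3` — the order GROWS (`e₂ ≥ 2`), Fukuda Thm. 1 (1) cannot apply at `(1,2)`; THIS SEAT's kit j316854 (direct layer 2, `K⁺₂ = K⁺·ℚ(ζ₂₇)⁺`, degree 36,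
> `bnfinit` under GRH, 3209 s): `h(K⁺₂) = 18`, `Cl ≅ [18]`, primes above `3`: `[[9,1],[18,1],[9,1]]` ⇒ `e₂ = 2`, `r₂ = 1 = r₁` — Fukuda Thm. 1 (2) at `(1,2)` applies (displayed
> `hrk`); the coinvariant test of kit j316734 (`rank₃ A(F₂)_G = 1`) is consistent.  GRH enters through `h(K⁺₁)` and `h(K⁺₂)`.  (conjA-anchor g8's FUKUDA-K(1,2) verdict for these
> rows, `e = 0,1,2`, `r = 0,1,1`, was computed on the OTHER, non-real quartic `x⁴ − 26x² + 208`; the values on the real quartic happen to coincide.)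
> 
> References: [Fukuda1994] Thm. 1; [Serre1972] §2.2, §2.4 Prop. 15; [FerreroWashington1979]; [CoatesSujatha2005] 3.4; [Kato2004Asterisque] 12.5 (3), 14.5 (3); [Lang1990] Ch. 13 §4
> Lemma 4.1; [Cremona1997] §3.8; [Cremona2006].
> 
-/

set_option autoImplicit false
set_option linter.dupNamespace false

noncomputable section

open scoped Classical NumberField
open Polynomial WeierstrassCurve Field IntermediateField IsDedekindDomain
  Literature.NumberTheory.EllipticCurves Literature.NumberTheory.EllipticCurves.Rank1Residual
  Literature.NumberTheory.EllipticCurves.Rank1Residual.Typed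
  Literature.NumberTheory.GaloisRepresentations Literature.NumberTheory.SerreUniformity Literature.NumberTheory.IwasawaTheory
  Summit.BirchSwinnertonDyer.Rank1Residual Summit.BirchSwinnertonDyer.Rank1Residual.Additive
  Summit.BirchSwinnertonDyer.BirchSwinnertonDyer.Theorems

namespace Summit.BirchSwinnertonDyer.BirchSwinnertonDyer.Theorems.WildUpperUnitTwistRecords

/-! ### `292032ej1` @ `p = 3` — `N = 292032 = 2^6·3^3·13^2`; Cremona: `r_an = 0`; O6 wild at `3`; flat row (`3 ∤ ∏c_ℓ`; node 19189 via the unit-twist road); conjA-anchor g8: `FUKUDA-K(1,2)[paper descent,GRH]`;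
kernel lemmas in `…WildUpperUnitTwistRecordsClassO612` (`classO6`) / `…WildUpperUnitTwistRecordsFlat28` (`irr`, `isElliptic`, `isGloballyMinimal`).  KIT j314795 (k9-c4 g22): `ψ₃ = (x² + 676x − 26364)·(3·x^2 − 2028·x + 659100)`
(quadratic discriminant `562432`; it carries a REAL `3`-torsion point `P`); `K⁺ ≅ ℚ(P) ≅ ℚ[x]/(x^4 + 26*x^2 - 156)` (signature `[2,1]`): `h = 2` (`Cl ≅ [2]`, CERTIFIED), primes above `3`: `[[1,1],[2,1],[1,1]]`;
`F = K⁺₁ = K⁺·ℚ(ζ₉)⁺` (degree 12): `h = 6` (`Cl ≅ [6]`, GRH), primes above `3`: `[[3,1],[6,1],[3,1]]` ⟹ `e₀ = 0 < e₁ = 1` (layer `(0,1)` silent).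
KIT j315805 (this seat, field `K6` = `x^4 + 26*x^2 - 156`): door UG at `(1,2)` FAILS (UG-FAIL(1,2): gen 0 totram 1 unit-index 0 (rank 1 of 2) => no conclusion from layer 1 (phase 2 decides)); direct layer 2: `K⁺₂ = K⁺·ℚ(ζ₂₇)⁺` (degree 36, kit j316854, GRH): `e₂ = 2`, `r₂ = 1` ⟹ `e₁ = 1 < e₂ = 2` but `r₂(K⁺) = r₁(K⁺) = 1` (Fukuda Thm. 1 (2) at `(1,2)`). -/

/-- **[NoF re-issue: the named facts `hLim`/`hF1`/`hF2`/`hCS` displayed by the original are DISCHARGED here by the tree theorems `…_holds` — read «modulo hLim/hF1/hF2/hCS» below as «no longer assumed».]** **RECORD (second road, on `K⁺ = ℚ(E[3])^c`) — UPPER half `ord₃ #Ш(E) ≤ ord₃ #Ш(E)_an` for `E = 292032ej1` at `p = 3` FROM ONE FUKUDA `3`-RANK EQUALITY `r_2(K⁺) = r_1(K⁺)`**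
(U₀-ns row of K9 items 19189 / 19197; door `CartanMuRoadFukudaDoorsWild.missingUpperBoundAt_three_of_hasSplitCartanNormalizerModPImage_of_realRankSuccEqAt`, n = 1).  KERNEL
(imported / above): `Δ ≠ 0`, minimality, `irr_g292032ej1_3`, `classO6_g292032ej1_3`, `hasSplitCartanNormalizerModPImage_g292032ej1_3`.  DISPLAYED: named facts
`hKatoA hGZK hmod hCS hFW hF2`; Cremona's `r_an = 0` (`hr`); a complex conjugation `c` (`hc`); `hrk : r_2(K⁺) = r_1(K⁺)` for `K⁺ = Fix(c|_L)` (numerically `1 = 1`;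
the ORDER grows `e_1 = 1 < e_2 = 2`: `K⁺₁`: `Cl ≅ [6]` GRH (kit j314795); `K⁺₂` (degree 36): kit j316854, GRH).  Per row; CONDITIONAL; nothing booked; BSD is not proved by this. [cite: Kato2004Asterisque, Thm. 14.5 (3) (p. 236), Thm. 12.5 (3) (p. 222)]
[cite: Fukuda1994, Thm. 1 (2), p. 264] [cite: Lang1990, Ch. 13 §4, Lemma 4.1] [cite: CoatesSujatha2005, Thm. 3.4 (§3)] [cite: Serre1972, §2.4 Prop. 15, §5.2 (iv)] [cite: Cremona2006, Table 1 (Cremona label 292032ej1)] -/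
theorem missingUpperBoundAt_g292032ej1_3_fkK12rNoF
    (hKatoA : Kato2004.rankZero_padicValNat_sha_add_padicValNat_tamagawa_le_of_additive_potGood_of_irreducible_of_fineSelmerDual_fg)
    (hGZK : rank_eq_analyticRank_of_analyticRank_le_one) (hmod : hasEntireLFunction_rat)
    (hFW : ferreroWashington1979_classicalMuVanishes)
    {W : WeierstrassCurve ℚ} [W.IsElliptic] [W.IsGloballyMinimal] (hWeq : W = (⟨0, 0, 0, (-131820), 41584816⟩ : WeierstrassCurve ℚ)) (hr : W.analyticRank = 0)
    {c : absoluteGaloisGroup ℚ} (hc : IsComplexConjugation (Rat.castHom ℝ) c)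
    (hrk : haveI : NumberField ↥(W.divisionField 3) := NumberField.mk
      ∀ κE : ZpExtension ↥(fixedField (Subgroup.zpowers (absRestrictNormalHom (W.divisionField 3) c))) 3,
        κE.IsCyclotomic → classGroupPRank κE (1 + 1) = classGroupPRank κE 1) :
    MissingUpperBoundAt W 3 := by
  subst hWeq
  haveI : Fact (Nat.Prime 3) := ⟨Nat.prime_three⟩
  exact CartanMuRoadFukudaDoorsWild.missingUpperBoundAt_three_of_hasSplitCartanNormalizerModPImage_of_realRankSuccEqAt _ hKatoA hGZK hmod CoatesSujatha2005.thm34_fineSelmerDual_moduleFinite_of_classicalMuVanishes_divisionField_holds hFW fukuda1994_thm1_classGroupPRank_const_of_succ_eq_holds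
    hr classO6_g292032ej1_3 irr_g292032ej1_3 hasSplitCartanNormalizerModPImage_g292032ej1_3 hc 1 hrk

/-! ### `292032en1` @ `p = 3` — `N = 292032 = 2^6·3^3·13^2`; Cremona: `r_an = 0`; O6 wild at `3`; flat row (`3 ∤ ∏c_ℓ`; node 19189 via the unit-twist road); conjA-anchor g8: `FUKUDA-K(1,2)[paper descent,GRH]`;
kernel lemmas in `…WildUpperUnitTwistRecordsClassO612` (`classO6`) / `…WildUpperUnitTwistRecordsFlat29` (`irr`, `isElliptic`, `isGloballyMinimal`).  KIT j314795 (k9-c4 g22): `ψ₃ = (x² + 52x − 156)·(3·x^2 − 156·x + 3900)`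
(quadratic discriminant `3328`; it carries a REAL `3`-torsion point `P`); `K⁺ ≅ ℚ(P) ≅ ℚ[x]/(x^4 + 26*x^2 - 156)` (signature `[2,1]`): `h = 2` (`Cl ≅ [2]`, CERTIFIED), primes above `3`: `[[1,1],[2,1],[1,1]]`;
`F = K⁺₁ = K⁺·ℚ(ζ₉)⁺` (degree 12): `h = 6` (`Cl ≅ [6]`, GRH), primes above `3`: `[[3,1],[6,1],[3,1]]` ⟹ `e₀ = 0 < e₁ = 1` (layer `(0,1)` silent).
KIT j315805 (this seat, field `K6` = `x^4 + 26*x^2 - 156`): door UG at `(1,2)` FAILS (UG-FAIL(1,2): gen 0 totram 1 unit-index 0 (rank 1 of 2) => no conclusion from layer 1 (phase 2 decides)); direct layer 2: `K⁺₂ = K⁺·ℚ(ζ₂₇)⁺` (degree 36, kit j316854, GRH): `e₂ = 2`, `r₂ = 1` ⟹ `e₁ = 1 < e₂ = 2` but `r₂(K⁺) = r₁(K⁺) = 1` (Fukuda Thm. 1 (2) at `(1,2)`). -/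

/-- **[NoF re-issue: the named facts `hLim`/`hF1`/`hF2`/`hCS` displayed by the original are DISCHARGED here by the tree theorems `…_holds` — read «modulo hLim/hF1/hF2/hCS» below as «no longer assumed».]** **RECORD (second road, on `K⁺ = ℚ(E[3])^c`) — UPPER half `ord₃ #Ш(E) ≤ ord₃ #Ш(E)_an` for `E = 292032en1` at `p = 3` FROM ONE FUKUDA `3`-RANK EQUALITY `r_2(K⁺) = r_1(K⁺)`**
(U₀-ns row of K9 items 19189 / 19197; door `CartanMuRoadFukudaDoorsWild.missingUpperBoundAt_three_of_hasSplitCartanNormalizerModPImage_of_realRankSuccEqAt`, n = 1).  KERNEL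
(imported / above): `Δ ≠ 0`, minimality, `irr_g292032en1_3`, `classO6_g292032en1_3`, `hasSplitCartanNormalizerModPImage_g292032en1_3`.  DISPLAYED: named facts
`hKatoA hGZK hmod hCS hFW hF2`; Cremona's `r_an = 0` (`hr`); a complex conjugation `c` (`hc`); `hrk : r_2(K⁺) = r_1(K⁺)` for `K⁺ = Fix(c|_L)` (numerically `1 = 1`;
the ORDER grows `e_1 = 1 < e_2 = 2`: `K⁺₁`: `Cl ≅ [6]` GRH (kit j314795); `K⁺₂` (degree 36): kit j316854, GRH).  Per row; CONDITIONAL; nothing booked; BSD is not proved by this. [cite: Kato2004Asterisque, Thm. 14.5 (3) (p. 236), Thm. 12.5 (3) (p. 222)]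
[cite: Fukuda1994, Thm. 1 (2), p. 264] [cite: Lang1990, Ch. 13 §4, Lemma 4.1] [cite: CoatesSujatha2005, Thm. 3.4 (§3)] [cite: Serre1972, §2.4 Prop. 15, §5.2 (iv)] [cite: Cremona2006, Table 1 (Cremona label 292032en1)] -/
theorem missingUpperBoundAt_g292032en1_3_fkK12rNoF
    (hKatoA : Kato2004.rankZero_padicValNat_sha_add_padicValNat_tamagawa_le_of_additive_potGood_of_irreducible_of_fineSelmerDual_fg)
    (hGZK : rank_eq_analyticRank_of_analyticRank_le_one) (hmod : hasEntireLFunction_rat)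
    (hFW : ferreroWashington1979_classicalMuVanishes)
    {W : WeierstrassCurve ℚ} [W.IsElliptic] [W.IsGloballyMinimal] (hWeq : W = (⟨0, 0, 0, (-780), 18928⟩ : WeierstrassCurve ℚ)) (hr : W.analyticRank = 0)
    {c : absoluteGaloisGroup ℚ} (hc : IsComplexConjugation (Rat.castHom ℝ) c)
    (hrk : haveI : NumberField ↥(W.divisionField 3) := NumberField.mk
      ∀ κE : ZpExtension ↥(fixedField (Subgroup.zpowers (absRestrictNormalHom (W.divisionField 3) c))) 3,
        κE.IsCyclotomic → classGroupPRank κE (1 + 1) = classGroupPRank κE 1) :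
    MissingUpperBoundAt W 3 := by
  subst hWeq
  haveI : Fact (Nat.Prime 3) := ⟨Nat.prime_three⟩
  exact CartanMuRoadFukudaDoorsWild.missingUpperBoundAt_three_of_hasSplitCartanNormalizerModPImage_of_realRankSuccEqAt _ hKatoA hGZK hmod CoatesSujatha2005.thm34_fineSelmerDual_moduleFinite_of_classicalMuVanishes_divisionField_holds hFW fukuda1994_thm1_classGroupPRank_const_of_succ_eq_holds
    hr classO6_g292032en1_3 irr_g292032en1_3 hasSplitCartanNormalizerModPImage_g292032en1_3 hc 1 hrk

end Summit.BirchSwinnertonDyer.BirchSwinnertonDyer.Theorems.WildUpperUnitTwistRecords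

end
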